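/-
Copyright: pub-hodgecm formalisation cell (harness21, 2026). New file (not vendored).
-/
import Summits.HodgeConjecture.HodgeCM.Geometry.Statements
import Summits.HodgeConjecture.HodgeCM.CM.Lemmas

/-!
# Stub tree, part 0: CM-type combinatorics (rfwf §1–2, PerL rem:tetra) — ALL PROVED (gen 2)

Elementary statements about CM types, faces and frames, proved in Mathlib as they stand (no model
hypothesis).  This file was part of the stub tree (4 placeholder stubs) until gen 2; it now carries no placeholder
and is kept in `HodgeCM/StubTree/` only so that the decl names `HodgeCM.StubTree.*` consumed by
`PerLProof`/`Reduction`/`Assembly` do not move.  PROVED companions elsewhere: `HodgeCM.CM.Lemmas` —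
`sumTwo_corner` (rfwf L1.2), `pairSum_psi` (rem:tetra), `admissible_mem_psi`, `lemma33b_signs`.
Inputs from Mathlib: `NumberField.IsTotallyComplex.finrank` (a CM field of degree `2g` has exactly `g`
infinite places), `NumberField.InfinitePlace.mk_eq_iff` (the fibre of `mk` is `{φ, φ̄}`).
-/

noncomputable section

namespace HodgeCM

open Literature.AlgebraicGeometry.Motives (CMType)
open NumberField NumberField.ComplexEmbedding CMTypeOps

namespace StubTree

/-- The four period types of a face are pairwise distinct (uses `π ≠ π′`; transposition item (T2) of
rfwf §4.2).  Proof: the pair of indicators at `(p, p′)` is `(a,b), (1-a,1-b), (1-a,b), (a,1-b)` for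
`Ψ₁ … Ψ₄`, pairwise distinct for `a, b ∈ {0,1}`. -/
theorem psi_injective (K : CMField) (f : Face K) : Function.Injective f.psi := by
  classical
  have hp : f.p ∈ placeSet f.p := by simp [placeSet]
  have hp' : f.p' ∈ placeSet f.p' := by simp [placeSet]
  have hpn : f.p ∉ placeSet f.p' := fun h => Face.not_mem_both f hp h
  have hp'n : f.p' ∉ placeSet f.p := fun h => Face.not_mem_both f h hp'
  have k1 : ind (flip f.p' (flip f.p f.Φ)) f.p = 1 - ind f.Φ f.p := by
    rw [ind_flip_of_not_mem hpn, ind_flip_of_mem hp]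
  have k2 : ind (flip f.p' (flip f.p f.Φ)) f.p' = 1 - ind f.Φ f.p' := by
    rw [ind_flip_of_mem hp', ind_flip_of_not_mem hp'n]
  have k3 : ind (flip f.p f.Φ) f.p = 1 - ind f.Φ f.p := by rw [ind_flip_of_mem hp]
  have k4 : ind (flip f.p f.Φ) f.p' = ind f.Φ f.p' := by rw [ind_flip_of_not_mem hp'n]
  have k5 : ind (flip f.p' f.Φ) f.p = ind f.Φ f.p := by rw [ind_flip_of_not_mem hpn]
  have k6 : ind (flip f.p' f.Φ) f.p' = 1 - ind f.Φ f.p' := by rw [ind_flip_of_mem hp']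
  have hc : ∀ i, (ind (f.psi i) f.p, ind (f.psi i) f.p') =
      (![(ind f.Φ f.p, ind f.Φ f.p'), (1 - ind f.Φ f.p, 1 - ind f.Φ f.p'),
         (1 - ind f.Φ f.p, ind f.Φ f.p'), (ind f.Φ f.p, 1 - ind f.Φ f.p')] : Fin 4 → ℤ × ℤ) i := by
    intro i
    fin_cases i <;> simp [Face.psi, k1, k2, k3, k4, k5, k6]
  intro i i' h
  have e := hc i
  rw [h, hc i'] at e
  clear h hc
  rcases ind_eq f.Φ f.p with ha | ha <;> rcases ind_eq f.Φ f.p' with hb | hb <;>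
    · simp only [ha, hb] at e
      revert i i' e
      decide

/-- **rfwf Lemma 2.1** `lem:distinct`: for `[F:ℚ] ≥ 6` every face has an admissible embedding.
Proof: `F` is totally complex, so it has `[F:ℚ]/2 ≥ 3` infinite places; pick one different from `π, π′`
and the element of `Φ` above it. -/
theorem admissible_exists : Universe.AdmissibleExists := by
  intro F hF f
  classical
  have hcard : 3 ≤ Fintype.card (InfinitePlace F) := by
    have h1 := InfinitePlace.card_eq_nrRealPlaces_add_nrComplexPlaces (K := F)
    have h2 := IsTotallyComplex.finrank (K := F)
    have h3 := IsTotallyComplex.nrRealPlaces_eq_zero (K := F)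
    omega
  obtain ⟨w, hw⟩ : ∃ w : InfinitePlace F, w ≠ InfinitePlace.mk f.p ∧ w ≠ InfinitePlace.mk f.p' := by
    by_contra h
    push Not at h
    have hsub : (Finset.univ : Finset (InfinitePlace F)) ⊆
        ({InfinitePlace.mk f.p, InfinitePlace.mk f.p'} : Finset _) := by
      intro w _
      by_cases h1 : w = InfinitePlace.mk f.p
      · simp [h1]
      · simp [h w h1]
    have h4 := Finset.card_le_card hsub
    rw [Finset.card_univ] at h4
    have h5 : ({InfinitePlace.mk f.p, InfinitePlace.mk f.p'} : Finset _).card ≤ 2 := Finset.card_le_two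
    omega
  have hφ : InfinitePlace.mk w.embedding = w := InfinitePlace.mk_embedding w
  by_cases hm : w.embedding ∈ f.Φ.1
  · refine ⟨w.embedding, hm, ?_, ?_⟩
    · rw [hφ]; exact hw.1
    · rw [hφ]; exact hw.2
  · refine ⟨conjugate w.embedding, (conjugate_mem_iff_notMem _ _).mpr hm, ?_, ?_⟩
    · rw [InfinitePlace.mk_conjugate_eq, hφ]; exact hw.1
    · rw [InfinitePlace.mk_conjugate_eq, hφ]; exact hw.2

/-- **PerL rem:tetra for the sextic types**: the types `t¹,…,t⁴` of a frame satisfy the pair-sum identity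
(`(+,+,+) + (+,−,−) = (+,−,+) + (+,+,−)` placewise).  Proof: the three places of the frame exhaust the
three infinite places of the sextic CM field, so every embedding is some `φⱼ` or `φ̄ⱼ`; at `φⱼ` the
identity is the sign table, at `φ̄ⱼ` its complement.  (`hK` is implied by `hφ` + CM and kept only for
the statement's provenance.) -/
theorem pairSum_of_isPerLTypes (K : CMField) (φ : Fin 3 → (K →+* ℂ)) (hφ : IsFrame φ)
    (hK : Module.finrank ℚ K = 6) (t : Fin 4 → CMType K) (ht : IsPerLTypes φ t) : PairSum t := by
  classical
  have hcard : Fintype.card (InfinitePlace K) = 3 := by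
    have h1 := InfinitePlace.card_eq_nrRealPlaces_add_nrComplexPlaces (K := K)
    have h2 := IsTotallyComplex.finrank (K := K)
    have h3 := IsTotallyComplex.nrRealPlaces_eq_zero (K := K)
    omega
  have hinj : Function.Injective (fun j => InfinitePlace.mk (φ j)) := by
    intro j j' h
    by_contra hne
    exact hφ j j' hne h
  have hsurj : Function.Surjective (fun j => InfinitePlace.mk (φ j)) :=
    ((Fintype.bijective_iff_injective_and_card _).mpr ⟨hinj, by simp [hcard]⟩).2
  have hs : ∀ i j, ind (t i) (φ j) = if perlSign i j then 1 else 0 := by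
    intro i j
    by_cases hm : φ j ∈ (t i).1
    · rw [ind_of_mem hm, if_pos ((ht i j).mp hm)]
    · rw [ind_of_not_mem hm, if_neg (fun h => hm ((ht i j).mpr h))]
  have hc : ∀ i j, ind (t i) (conjugate (φ j)) = 1 - ind (t i) (φ j) := by
    intro i j
    by_cases hm : φ j ∈ (t i).1
    · rw [ind_of_mem hm, ind_of_not_mem ((mem_iff_conjugate_notMem _ _).mp hm)]; norm_num
    · rw [ind_of_not_mem hm, ind_of_mem ((conjugate_mem_iff_notMem _ _).mpr hm)]; norm_num
  have hrow : ∀ j : Fin 3, (if perlSign 0 j then (1 : ℤ) else 0) + (if perlSign 1 j then 1 else 0)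
      = (if perlSign 2 j then 1 else 0) + (if perlSign 3 j then 1 else 0) := by decide
  intro ψ
  obtain ⟨j, hj⟩ := hsurj (InfinitePlace.mk ψ)
  simp only at hj
  rw [InfinitePlace.mk_eq_iff] at hj
  rcases hj with hj | hj
  · subst hj
    rw [hs 0, hs 1, hs 2, hs 3]
    exact hrow j
  · subst hj
    rw [hc 0, hc 1, hc 2, hc 3, hs 0, hs 1, hs 2, hs 3]
    linarith [hrow j]

/-- The sextic types are pairwise distinct (the rows of the sign table are). -/
theorem injective_of_isPerLTypes (K : CMField) (φ : Fin 3 → (K →+* ℂ)) (_hφ : IsFrame φ)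
    (t : Fin 4 → CMType K) (ht : IsPerLTypes φ t) : Function.Injective t := by
  intro i i' h
  have key : ∀ j, perlSign i j = perlSign i' j := by
    intro j
    have h1 := ht i j
    have h2 := ht i' j
    rw [h] at h1
    cases hij : perlSign i j <;> cases hij' : perlSign i' j <;> simp_all
  have hrows : ∀ a b : Fin 4, perlSign a = perlSign b → a = b := by decide
  exact hrows i i' (funext key)

end StubTree

end HodgeCM

end
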